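import Summits.FinalStateConjecture.FinalStateConjecture.Theorems.SwallowTheDatumSubdataDevelopmentsEmbedLocalisation
import Literature.Geometry.Lorentzian.ChainUnionDevelopment
import Literature.Geometry.Lorentzian.MCGHDNoCorrespondingBoundary

/-!
# Route SwallowTheDatum · item `SubdataDevelopmentsEmbed` (stmt-FinalStateConjecture-10053) —
# the localisation principle, pointwise: a maximal development of the SUB-datum suffices

`subdataDevelopmentsEmbed_of_choquetBruhatGeroch_of_causalCompact` (`…Localisation.lean`) uses
the named fact `choquetBruhat_geroch_exists_mghd_cauchy` at exactly one place: to get a MAXIMAL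
vacuum Cauchy development `M̃` of the sub-datum `Φ^* D` (which is developable, by the given `𝒟'`).
This file displays that use, so that the ledger shows what the item owes beyond the tree:

* `exists_embedding_of_isMaximal_subdatum` — **pointwise core**: for a maximal vacuum Cauchy
  development `𝒟` of `D`, a smooth open embedding `Φ : N → X` with injective differentials, a
  vacuum Cauchy development `𝒟'` of `Φ^* D` and ANY maximal vacuum Cauchy development `M̃` of
  `Φ^* D`, the embedding `χ : 𝒟' → 𝒟` over `Φ` exists (global hyperbolicity of Cauchy
  developments displayed by name, `hawkingEllis_cauchyDevelopment_causalCompact_closed`, a theorem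
  of the tree: `…_holds`, `CauchyDevelopmentGlobalHyperbolicityProofs`);
* `subdataDevelopmentsEmbed_of_exists_isMaximal_of_causalCompact` — **the item from MGHD
  existence for DEVELOPABLE data** (hypothesis `hmaxdev`: every datum on a connected Hausdorff
  second countable `3`-manifold admitting a vacuum Cauchy development admits a maximal one — the
  hypothesis `hmax` of `subdataDevelopmentsEmbed_iff_relative_extension`, `…SubdataDevelopmentsEmbed.lean`)
  and the global-hyperbolicity fact. In particular no local EXISTENCE theorem is needed: by
  `VacuumCauchyDevelopment.exists_isMaximal_of_nonempty_of_common_extension`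
  (`ChainUnionDevelopment`) and `choquetBruhat_geroch_common_extension_of_localTheory_of_exists_lt`
  (`MCGHDNoCorrespondingBoundary`), `hmaxdev` follows from local geometric uniqueness and
  Sbierski's Theorem 12 for developments of the same data —
  `subdataDevelopmentsEmbed_of_localTheory_of_thm12_of_causalCompact`;
* `relative_extension_of_exists_isMaximal_of_causalCompact` — under the same hypotheses the
  relative extension property of `…SubdataDevelopmentsEmbed.lean` holds outright.

The proof of the core is that of `subdataDevelopmentsEmbed_of_choquetBruhatGeroch_of_causalCompact`
verbatim, started from the given `M̃` (Hawking–Ellis 1973, §7.6, p. 251; Choquet-Bruhat–Geroch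
1969, p. 334). Pure composition; no definition; no new named fact.
-/

noncomputable section

open Function Set Filter Topology TopologicalSpace Bundle
open scoped Manifold ContDiff Topology

namespace Summit.FinalStateConjecture.FinalStateConjecture.Theorems

namespace SubdataDevelopmentsEmbed

open Literature.Geometry.Lorentzian

/-- **Pointwise core of the localisation principle**: given a maximal vacuum Cauchy development
`𝒟` of `D` on `X`, a smooth open embedding `Φ : N → X` with injective differentials (`N`
connected), a vacuum Cauchy development `𝒟'` of the sub-datum `Φ^* D` and a MAXIMAL vacuum Cauchy
development `M̃` of `Φ^* D`, there is a smooth, time-orientation preserving, isometric open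
embedding `χ : 𝒟' → 𝒟` with `χ ∘ ι' = ι ∘ Φ` — namely `ζ ∘ j' ∘ χ'`, where `χ' : 𝒟' → M̃` and
`θ : R → M̃` (from the domain of dependence `R` of `ι(Φ N)` in `𝒟`) come from maximality of `M̃`,
`j' : M̃ → Z = 𝒟 ∪_{θ⁻¹} M̃` from the relative gluing (no corresponding boundary points: cluster
points of `θ⁻¹` at `∂θ(R)` would lie in `θ⁻¹(θ R)`), and `ζ : Z → 𝒟` from maximality of `𝒟`.
Global hyperbolicity of Cauchy developments is displayed by name (`hgh`).
[cite: HawkingEllis1973CUP, §7.6, pp. 249–251] [cite: ChoquetBruhatGeroch1969CMP, Thm. 3 and p. 334] -/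
theorem exists_embedding_of_isMaximal_subdatum
    (hgh : hawkingEllis_cauchyDevelopment_causalCompact_closed)
    (X : Type) [TopologicalSpace X] [ChartedSpace E3 X] [IsManifold (𝓡 3) ∞ X]
    [T2Space X] [SecondCountableTopology X] [ConnectedSpace X] (D : InitialDataSet (𝓡 3) X)
    (𝒟 : VacuumCauchyDevelopment D) (hmax : 𝒟.IsMaximal)
    (N : Type) [TopologicalSpace N] [ChartedSpace E3 N] [IsManifold (𝓡 3) ∞ N]
    [ConnectedSpace N] (Φ : N → X) (hΦ : ContMDiff (𝓡 3) (𝓡 3) (∞ + 1) Φ)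
    (hΦ' : ∀ u, Injective (mfderiv (𝓡 3) (𝓡 3) Φ u)) (hΦo : IsOpenEmbedding Φ)
    (𝒟' : VacuumCauchyDevelopment (D.comap Φ hΦ hΦ'))
    (M : VacuumCauchyDevelopment (D.comap Φ hΦ hΦ')) (hM : M.IsMaximal) :
    ∃ χ : 𝒟'.carrier → 𝒟.carrier,
      ContMDiff (𝓡 4) (𝓡 4) ∞ χ ∧ IsOpenEmbedding χ ∧
        𝒟'.metric.IsIsometricImmersion 𝒟.metric.toPseudoRiemannianMetric χ ∧
        𝒟'.timeOrientation.PreservesTimeOrientation χ 𝒟.timeOrientation ∧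
        χ ∘ 𝒟'.embed = 𝒟.embed ∘ Φ := by
  classical
  -- the domain of dependence `V` of `ι(Φ N)` in `𝒟` and the development `R` of the sub-datum
  obtain ⟨n₀⟩ : Nonempty N := inferInstance
  have hslab : ∀ a ∈ range 𝒟.embed, ∃ ν : TangentSpace (𝓡 4) a,
      𝒟.metric.IsTimelike ν ∧ 𝒟.timeOrientation.IsFutureDirected ν ∧
      ∀ κ : ℝ, 0 < κ → ∀ᶠ σ in 𝓝 a, σ ∈ range 𝒟.embed →
        |𝒟.metric.val a ν (extChartAt (𝓡 4) a σ - extChartAt (𝓡 4) a a)| ≤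
          κ * ‖extChartAt (𝓡 4) a σ - extChartAt (𝓡 4) a a‖ := by
    rintro _ ⟨y, rfl⟩
    refine ⟨𝒟.normal y, ?_, 𝒟.isFutureUnitNormal.2 y, fun κ hκ ↦
      𝒟.toDataEmbedding.eventually_abs_val_normal_le y hκ⟩
    show 𝒟.metric.val _ (𝒟.normal y) (𝒟.normal y) < 0
    rw [𝒟.isFutureUnitNormal.1.2 y]
    norm_num
  obtain ⟨V, -, hVc, hιV, hVcl, hVC⟩ := exists_cauchyPieceDomain 𝒟 hΦo hslab n₀
  have hν : ∀ u, MDifferentiableAt (𝓡 3) (𝓡 4).tangent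
      (fun x ↦ (TotalSpace.mk' (EuclideanSpace ℝ (Fin 4)) (𝒟.embed x) (𝒟.normal x) :
        TangentBundle (𝓡 4) 𝒟.carrier)) (Φ u) := fun u ↦
    𝒟.toDataEmbedding.mdifferentiableAt_embed_normal (Φ u)
  have hVC' : (𝒟.metric.restrict PseudoRiemannianMetric.contMDiff_restrict_holds V).IsCauchyHypersurface
      (𝒟.timeOrientation.restrict PseudoRiemannianMetric.contMDiff_restrict_holds
        𝒟.timeOrientation.contMDiff_restrict_holds V)
      (range ((𝒟.toDataEmbedding.comapAlong Φ hΦ hΦ' hΦo hν).embedOpens V hιV)) := by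
    intro γ s hγ
    obtain ⟨t, ⟨hts, u, hu⟩, huniq⟩ := hVC γ s hγ
    refine ⟨t, ⟨hts, u, Subtype.ext hu⟩, fun t' ht' ↦ huniq t' ⟨ht'.1, ?_⟩⟩
    obtain ⟨u', hu'⟩ := ht'.2
    exact ⟨u', congrArg Subtype.val hu'⟩
  set R : VacuumCauchyDevelopment (D.comap Φ hΦ hΦ') :=
    𝒟.comapAlongRestrict Φ hΦ hΦ' hΦo hν V hVc hιV hVC' with hR_def
  -- `θ : R → M` by maximality of `M`
  obtain ⟨θ, hθs, hθo, hθi, hθt, hθc⟩ := hM R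
  -- the inclusion `k = Subtype.val : R → 𝒟` over `Φ`
  set k : R.carrier → 𝒟.carrier := fun y ↦ y.1 with hk_def
  have hks : ContMDiff (𝓡 4) (𝓡 4) ∞ k := contMDiff_subtype_val
  have hki : R.metric.IsIsometricImmersion 𝒟.metric.toPseudoRiemannianMetric k := by
    refine ⟨hks, fun y ↦ ?_⟩
    ext v w
    rw [pullbackBilin_apply]
    change 𝒟.metric.val y.1 (mfderiv (𝓡 4) (𝓡 4) (Subtype.val : V → 𝒟.carrier) y v)
      (mfderiv (𝓡 4) (𝓡 4) (Subtype.val : V → 𝒟.carrier) y w) = 𝒟.metric.val y.1 v w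
    rw [mfderiv_subtypeVal]
    rfl
  have hkt : R.timeOrientation.PreservesTimeOrientation k 𝒟.timeOrientation := fun y ↦ by
    change 𝒟.timeOrientation.IsFutureDirected
      (mfderiv (𝓡 4) (𝓡 4) (Subtype.val : V → 𝒟.carrier) y (𝒟.timeOrientation.vectorField y.1))
    rw [mfderiv_subtypeVal]
    exact 𝒟.timeOrientation.isFutureDirected_vectorField y.1
  have hkc : k ∘ R.embed = 𝒟.embed ∘ Φ := rfl
  -- realise `R` inside `M` through `θ`: `(U, ψ) = (θ(R), val ∘ θ⁻¹)`
  obtain ⟨U, ψ, hP, hUeq, hψθ⟩ := exists_realised_rel R.toCauchyDevelopment M.toCauchyDevelopment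
    𝒟.toCauchyDevelopment hθs hθo hθi hθt hθc hks hki hkt hkc
  -- the image `ψ(U)` is `V`
  have himage : ψ '' (U : Set M.carrier) = (V : Set 𝒟.carrier) := by
    rw [hUeq]
    ext z
    constructor
    · rintro ⟨_, ⟨r, rfl⟩, rfl⟩
      rw [hψθ]
      exact r.2
    · intro hz
      exact ⟨θ ⟨z, hz⟩, ⟨⟨z, hz⟩, rfl⟩, by rw [hψθ]⟩
  -- global hyperbolicity of `𝒟` and `M` (theorems of the tree)
  obtain ⟨hK, hK', hrel⟩ := hgh X D 𝒟.toCauchyDevelopment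
  obtain ⟨hK₁, hK₁', -⟩ := hgh N (D.comap Φ hΦ hΦ') M.toCauchyDevelopment
  -- no cluster values of `ψ` at the frontier of `U`
  haveI : LocallyCompactSpace M.carrier :=
    ChartedSpace.locallyCompactSpace (EuclideanSpace ℝ (Fin 4)) M.carrier
  have hncb : ∀ p ∈ frontier (U : Set M.carrier), ∀ q : 𝒟.carrier,
      ¬ ClusterPt q (map ψ (𝓝[(U : Set M.carrier)] p)) := by
    intro p hp q hq
    obtain ⟨hqF, -, hinj, hopen, -⟩ := not_mem_closure_badSet_of_clusterPt 𝒟 hΦ hΦ' hΦo M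
      hK hK' hK₁ hK₁' (fun hx hy hxy ↦ hrel _ _ _ _ hx hy hxy)
      hslab U ψ hP hp hq
    -- `q ∈ closure ψ(U) = closure V`, hence `q ∈ V = ψ(U)`
    have hle : map ψ (𝓝[(U : Set M.carrier)] p) ≤ 𝓟 (ψ '' (U : Set M.carrier)) := by
      rw [← map_principal]
      exact map_mono (le_principal_iff.2 self_mem_nhdsWithin)
    have hqcl : q ∈ closure (ψ '' (U : Set M.carrier)) :=
      mem_closure_iff_clusterPt.2 (hq.mono hle)
    rw [himage] at hqcl
    have hqV : q ∈ (V : Set 𝒟.carrier) := hVcl ⟨hqcl, hqF⟩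
    rw [← himage] at hqV
    obtain ⟨y₀, hy₀U, rfl⟩ := hqV
    exact not_clusterPt_map_of_mem U.2 hinj hopen hp hy₀U hq
  -- the gluing `Z = 𝒟 ∪_ψ M`, receiving `M` over `Φ`
  obtain ⟨Z, jZ, j', ⟨-, -, -, -, -⟩, ⟨hj's, hj'o, hj'i, hj't, hj'c⟩, -⟩ :=
    hglue_of_relGluing M 𝒟 hΦo.injective U ψ hP hncb
  -- maximality of `𝒟` absorbs `Z`; `𝒟'` embeds into `M`
  obtain ⟨ζ, hζs, hζo, hζi, hζt, hζc⟩ := hmax Z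
  obtain ⟨χ', hχ's, hχ'o, hχ'i, hχ't, hχ'c⟩ := hM 𝒟'
  have hζj's : ContMDiff (𝓡 4) (𝓡 4) ∞ (ζ ∘ j') := hζs.comp hj's
  have hζj'i : M.metric.IsIsometricImmersion 𝒟.metric.toPseudoRiemannianMetric (ζ ∘ j') :=
    hζi.comp hj'i
  refine ⟨(ζ ∘ j') ∘ χ', hζj's.comp hχ's, (hζo.comp hj'o).comp hχ'o, hζj'i.comp hχ'i,
    (hζt.comp hj't hζi.2 (hζs.mdifferentiable (by simp)) (hj's.mdifferentiable (by simp))).comp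
      hχ't hζj'i.2 (hζj's.mdifferentiable (by simp)) (hχ's.mdifferentiable (by simp)), ?_⟩
  calc ((ζ ∘ j') ∘ χ') ∘ 𝒟'.embed = ζ ∘ j' ∘ (χ' ∘ 𝒟'.embed) := rfl
    _ = ζ ∘ (j' ∘ M.embed) := by rw [hχ'c]
    _ = ζ ∘ (Z.embed ∘ Φ) := by rw [hj'c]
    _ = (ζ ∘ Z.embed) ∘ Φ := rfl
    _ = 𝒟.embed ∘ Φ := by rw [hζc]

/-- **The item from MGHD existence for DEVELOPABLE data** (the hypothesis `hmax` of
`subdataDevelopmentsEmbed_iff_relative_extension`) **and the global hyperbolicity of Cauchy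
developments**: `N` is Hausdorff and second countable through the open embedding `Φ`, the
sub-datum `Φ^* D` is developable by the given `𝒟'`, so `hmaxdev` yields a maximal development of
`Φ^* D` and `exists_embedding_of_isMaximal_subdatum` applies. No local existence theorem enters.
[cite: HawkingEllis1973CUP, §7.6, p. 251] -/
theorem subdataDevelopmentsEmbed_of_exists_isMaximal_of_causalCompact
    (hmaxdev : ∀ (N : Type) [TopologicalSpace N] [ChartedSpace E3 N] [IsManifold (𝓡 3) ∞ N]
      [T2Space N] [SecondCountableTopology N] [ConnectedSpace N] (D₁ : InitialDataSet (𝓡 3) N),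
      Nonempty (VacuumCauchyDevelopment D₁) → ∃ M : VacuumCauchyDevelopment D₁, M.IsMaximal)
    (hgh : hawkingEllis_cauchyDevelopment_causalCompact_closed) :
    Summit.FinalStateConjecture.FinalStateConjecture.Theses.SwallowTheDatum.SubdataDevelopmentsEmbed := by
  unfold Theses.SwallowTheDatum.SubdataDevelopmentsEmbed
  intro X _ _ _ _ _ _ D 𝒟 hmax N _ _ _ _ Φ hΦ hΦ' hΦo 𝒟'
  haveI : T2Space N := hΦo.isEmbedding.t2Space
  haveI : SecondCountableTopology N := hΦo.isEmbedding.secondCountableTopology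
  obtain ⟨M, hM⟩ := hmaxdev N (D.comap Φ hΦ hΦ') ⟨𝒟'⟩
  exact exists_embedding_of_isMaximal_subdatum hgh X D 𝒟 hmax N Φ hΦ hΦ' hΦo 𝒟' M hM

/-- **The item from local geometric uniqueness and Sbierski's Theorem 12 for developments of the
SAME data, through the maximal development of the sub-datum** (a second derivation, independent of
the relative no-corresponding-boundary theorem `hncb_of_thm12` of `…NcbReduction.lean`): MGHD
existence for developable data follows from the common-extension theorem
(`choquetBruhat_geroch_common_extension_of_localTheory_of_exists_lt`: local theory `hlocal` — any
two vacuum Cauchy developments of a datum have a common globally hyperbolic development — plus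
Theorem 12 `h12`, the differentiability of unit normals being the theorem
`DataEmbedding.mdifferentiableAt_embed_normal`) and the union of chains
(`VacuumCauchyDevelopment.exists_isMaximal_of_nonempty_of_common_extension`), without any local
EXISTENCE statement. [cite: Sbierski2016AHP, Thm. 2.4 (ii), Thm. 3.5 and §3.3]
[cite: ChoquetBruhatGeroch1969CMP, proof of Thm. 3, pp. 332–334] -/
theorem subdataDevelopmentsEmbed_of_localTheory_of_thm12_of_causalCompact
    (hlocal : ∀ (N : Type) [TopologicalSpace N] [ChartedSpace E3 N] [IsManifold (𝓡 3) ∞ N]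
      [ConnectedSpace N] (D₁ : InitialDataSet (𝓡 3) N) (𝒟₁ 𝒟₂ : VacuumCauchyDevelopment D₁),
      ∃ U : Opens 𝒟₁.carrier, 𝒟₁.toCauchyDevelopment.IsCommonDevelopment 𝒟₂.toDataEmbedding U)
    (h12 : ∀ (N : Type) [TopologicalSpace N] [ChartedSpace E3 N] [IsManifold (𝓡 3) ∞ N]
      [ConnectedSpace N] (D₁ : InitialDataSet (𝓡 3) N) (𝒟₁ 𝒟₂ : VacuumCauchyDevelopment D₁)
      (𝔠 : CauchyDevelopment.CommonDevelopment 𝒟₁.toCauchyDevelopment 𝒟₂.toCauchyDevelopment),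
      𝔠.HasCorrespondingBoundaryPoints →
        ∃ V : Opens 𝒟₁.carrier,
          𝒟₁.toCauchyDevelopment.IsCommonDevelopment 𝒟₂.toDataEmbedding V ∧ 𝔠.opens < V)
    (hgh : hawkingEllis_cauchyDevelopment_causalCompact_closed) :
    Summit.FinalStateConjecture.FinalStateConjecture.Theses.SwallowTheDatum.SubdataDevelopmentsEmbed :=
  subdataDevelopmentsEmbed_of_exists_isMaximal_of_causalCompact
    (fun N _ _ _ _ _ _ D₁ hD₁ ↦
      VacuumCauchyDevelopment.exists_isMaximal_of_nonempty_of_common_extension hD₁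
        (choquetBruhat_geroch_common_extension_of_localTheory_of_exists_lt (hlocal N D₁) (h12 N D₁)
          fun 𝒟₁ x ↦ 𝒟₁.toDataEmbedding.mdifferentiableAt_embed_normal x))
    hgh

/-- **The relative extension property from MGHD existence for developable data** (and global
hyperbolicity): every vacuum Cauchy development of the sub-datum of a developable datum embeds over
`Φ` into SOME vacuum Cauchy development of the datum — combine
`subdataDevelopmentsEmbed_of_exists_isMaximal_of_causalCompact` with
`relative_extension_of_subdataDevelopmentsEmbed`. (Sbierski 2016, Thm. 2.7, relative form.)
[cite: Sbierski2016AHP, §2, Thm. 2.7–2.8] -/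
theorem relative_extension_of_exists_isMaximal_of_causalCompact
    (hmaxdev : ∀ (N : Type) [TopologicalSpace N] [ChartedSpace E3 N] [IsManifold (𝓡 3) ∞ N]
      [T2Space N] [SecondCountableTopology N] [ConnectedSpace N] (D₁ : InitialDataSet (𝓡 3) N),
      Nonempty (VacuumCauchyDevelopment D₁) → ∃ M : VacuumCauchyDevelopment D₁, M.IsMaximal)
    (hgh : hawkingEllis_cauchyDevelopment_causalCompact_closed)
    (X : Type) [TopologicalSpace X] [ChartedSpace E3 X] [IsManifold (𝓡 3) ∞ X]
    [T2Space X] [SecondCountableTopology X] [ConnectedSpace X] (D : InitialDataSet (𝓡 3) X)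
    (hD : Nonempty (VacuumCauchyDevelopment D))
    (N : Type) [TopologicalSpace N] [ChartedSpace E3 N] [IsManifold (𝓡 3) ∞ N]
    [ConnectedSpace N] (Φ : N → X) (hΦ : ContMDiff (𝓡 3) (𝓡 3) (∞ + 1) Φ)
    (hΦ' : ∀ u, Injective (mfderiv (𝓡 3) (𝓡 3) Φ u)) (hΦo : IsOpenEmbedding Φ)
    (𝒟' : VacuumCauchyDevelopment (D.comap Φ hΦ hΦ')) :
    ∃ (𝒟₃ : VacuumCauchyDevelopment D) (χ : 𝒟'.carrier → 𝒟₃.carrier),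
      ContMDiff (𝓡 4) (𝓡 4) ∞ χ ∧ IsOpenEmbedding χ ∧
        𝒟'.metric.IsIsometricImmersion 𝒟₃.metric.toPseudoRiemannianMetric χ ∧
        𝒟'.timeOrientation.PreservesTimeOrientation χ 𝒟₃.timeOrientation ∧
        χ ∘ 𝒟'.embed = 𝒟₃.embed ∘ Φ :=
  relative_extension_of_subdataDevelopmentsEmbed hmaxdev
    (subdataDevelopmentsEmbed_of_exists_isMaximal_of_causalCompact hmaxdev hgh) X D hD N Φ hΦ hΦ'
    hΦo 𝒟'

end SubdataDevelopmentsEmbed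

end Summit.FinalStateConjecture.FinalStateConjecture.Theorems

end
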